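import Summits.QuantumFields.YangMills.Theorems.BalabanUVNodesN20CoreEdgeShellDialStubText
import Summits.QuantumFields.YangMills.Theorems.BalabanUVNodesN20CoreEdgeShellDialDeviationTower
import Summits.QuantumFields.YangMills.Theorems.BalabanUVNodesK3V6Defs

/-!
# BalabanUVNodes ∕ N20 (NE7b) — the `hedge`-JOINT COMPANION, module 13R: module 13b RE-ISSUED AT K3⁸'s REGISTERED NAMES (skeleton v6 b4e55110ab73e679, stub 2
# `stub_expansion13HV`) — at the ℓ¹-optimal shell split the N19′ conjunct `KeyedCoreEdgeHolderD4V β cr⋆ rr` (and its (B)-free shape) HOLDS OUTRIGHT for every version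
# slot, three of the five conjuncts hold from NO estimate at `jc := 0`, the fourth (`KeyedShellWeight cr⋆`, v5's text kept verbatim by v6) follows from the window-key
# letters + (Dev) (module 13L) or + dag-n20-w4's class-law TV letter (module 13P), and FAILS for every constant reading under a deviation floor at one tuple (module 13N)

Cell `pub-ymgap` (HUMAN RULING D-0062 Track A; D-0149 width push), seat `pub-ymgap-dag-n20-w3` (WIDTH SEAT 3 of 3 on NODE n20 = NE7b) gen 7, CLAIM-4 ∕ INTENT-4
(pub-ymgap INBOX).  Filed `--kind proof --supports stmt-QuantumFields-27366 --as helper` (K3⁸ `SpineGivenEndpointR13SepCoPHV`, route rev 28∕29, dag-lead KEY MAP v2: the K3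
crux re-keyed through DEF-1's version slot `v : Node00.Revision₁₃ F 2 θ h`; stub texts mirrored BY NAME in dag-n27-w1's `Thm/BalabanUVNodesK3V6Defs` — `KeyedCoreEdgeHolderD4V`,
`KeyedCoreEdgeHolderD4BFree`, `keyedCoreEdgeHolderD4V_of_bFree`; v5's `PinnedAtLive ∕ KeyedRelWeight ∕ KeyedShellWeight` (`K3V5Defs`, p606160) are v6's verbatim).
COUNT-NEUTRAL.  ADDITIVE — imports this lineage's module 13b `…N20CoreEdgeShellDialStubText` (p609975: `pinnedAtLive_crOfRecord₁₃V`, `keyedShellWeight_crOfRecord₁₃V_optShell_of_l1Mismatch`;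
through it module 13 p608626 `core_crOfRecord₁₃VAt_optShell`, `relWeightBound_crOfRecord₁₃VAt_cutZero`), module 13P `…DeviationTower` (p624084:
`shellWeightBound_crOfRecord₁₃VAt_optShell_of_keyReading_of_classLawTV`; through it 13N p622642 `not_shellWeightBound_optShell_of_unsummable_fibreDev` and 13L p617153
`shellWeightBound_crOfRecord₁₃VAt_optShell_of_keyReading_of_fibreDev`) and `…K3V6Defs`; modifies nothing.  Like module 13b this file sits INSIDE the route's import cone
(`K3V6Defs` imports the Theses file) — the cone-free statements stay in modules 13 ∕ 13K–13Q.  [III] = [Balaban1988Convergent], [LF-I∕II] = [Balaban1989LargeFieldI∕II], [King1986] = CMP 102.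

WHY.  K3⁸'s stub 2 reads `… → KeyedRatesHolderD4V β (rrOfRecord 𝔯 ksel) → ∃ (jc : CutReading) (sh : ShellSplit₁₃CoPH 2 0) (cr : SpineReading), PinnedAtLive jc sh cr ∧
KeyedRelWeight cr ∧ KeyedShellWeight cr ∧ KeyedExtractionV cr ∧ KeyedCoreEdgeHolderD4V β cr (rrOfRecord 𝔯 ksel)` — v5's text with the (B)-prefixed faces read at the revised
datum.  The shell split `sh` is still FREE, so module 13's located degeneracy persists verbatim at v6:
* §1 ★★★ `keyedCoreEdgeHolderD4BFree_crOfRecord₁₃V_optShell` ∕ ★★★ `keyedCoreEdgeHolderD4V_crOfRecord₁₃V_optShell` — with `cr⋆ := crOfRecord₁₃V (jc …) sh⋆` pinned everywhere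
  and `sh⋆` the ℓ¹-optimal split at ANY constant reading `cK`, the N19′ conjunct of `stub_expansion13HV` HOLDS for EVERY `β`, EVERY rate reading, EVERY cut reading, EVERY version
  slot: the (B)-free shape by module 13's `core_crOfRecord₁₃VAt_optShell` under `ForSmallCouplings.of_forall` (the holder hypothesis `PHolderD4` UNREAD), the slot shape by
  `K3V6Defs.keyedCoreEdgeHolderD4V_of_bFree`.  ★★ `pinned_relWeight_coreEdgeV_optShell`: at `jc := 0` THREE of the five conjuncts (`PinnedAtLive`, `KeyedRelWeight` — dag-n20-w2's
  cut-zero face —, `KeyedCoreEdgeHolderD4V`) from NO estimate.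
* §2 the FOURTH conjunct `KeyedShellWeight cr⋆` (v5's text; module 13b's `keyedShellWeight_crOfRecord₁₃V_optShell_of_l1Mismatch` gives it from the PINNED letters verbatim at v6 —
  cited, not restated) from the WINDOW-ROAD letters per guarded admissible tuple: ★★ `keyedShellWeight_crOfRecord₁₃V_optShell_of_keyReading_of_fibreDev` ((W) at ANY key reading
  `kr` + the deviation letters there, fractions `w`, `v` — module 13L) and ★★ `…_of_keyReading_of_classLawTV` ((W) at any `kr` + positive totals + dag-n20-w4's class-law TV
  letter of radius `r` — module 13P; fraction `w + 2r`).
* §3 ★★ `not_keyedShellWeight_optShell_of_unsummable_fibreDevA` — if at ONE guarded admissible tuple the run-A deviation of the record's class weights has an UNSUMMABLE floor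
  inside the classes of some key reading, then `KeyedShellWeight cr⋆` FAILS for EVERY constant reading `cK` and every cut reading: the ℓ¹-optimal-shell road to stub 2's N21
  conjunct is closed there (module 13N's abstract kill at the reading's canonical `Wsh`; the all-dial form is module 13Q).  The floor is a HYPOTHESIS — NOT PRINTED, NOT measured.
LOCATED (for plan g85 ∕ CRIT-1 ∕ the K3⁸ lanes; said, not decided): v6 inherits v5's soft N19′∕N21 division under the free `∃ sh` UNCHANGED — the version slot touches only the
(B)-prefix; the honest content of the (N19′, N21) pair at the v6 pin is still ONE summable ℓ¹ letter per run (≡ (W at any window key) + (Dev) there, modules 13N∕13P), plus N27x.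

HONEST FRAMING.  By-name plumbing over dag-n20-d's reading of record, dag-n27-w1's v6 mirror and this lineage's modules; count-neutral; proves NO estimate of the programme: every
letter ((W), (Dev), the TV letter, the deviation floor) is a HYPOTHESIS inhabited for no Bałaban family (A2 declared); §1's hypothesis-free theorems book NOTHING about Bałaban's
objects beyond `0 ≤` class weights (they say where the REGISTERED v6 text puts its content, not that the content holds).  Nothing of Bałaban's asserted; no `Provisos₁₃CoPH` ∕
`Provisos₁₃SepCoPH` inhabitant claimed (K0⁷ OPEN); NE7 ∕ NE7b ∕ NE7c NOT PRINTED ∕ NOT PROVED; N19 ∕ N20 ∕ N21 ∕ N27x NOT discharged; `stub_expansion13HV` NOT closed (two of its five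
conjuncts carry all the content), K3⁸ ∕ K3⁷ OPEN, not claimed, v6 ∕ v5 STAND; counts unmoved; no count claim.  One finite `𝕋⁴_{L^K}` programme at fixed `ε = L^{−K}`, Bałaban AS
PRINTED; the YM mass gap (Clay) is NOT proved by any of this — R4 closes the conditional finite-𝕋⁴ rung `BalabanLadder.UV` only; NOT ℝ⁴, NOT continuum, NOT OS.  No `def`, no
`instance`, no `notation`, no `sorry`, no private decls.  Sources (location only): [King1986] (3.10)–(3.13) pp.656–657; [LF-I] p.193; [LF-II] Thm 1 + (0.1) pp.355–356; [III] (2.18) p.257.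
-/

noncomputable section

open Finset
open scoped BigOperators

namespace Summit.QuantumFields.YangMills.BalabanUVNodes.N20CoreEdgeShellDialStubTextK3V6

open Literature.MathematicalPhysics.QuantumFieldTheory.Balaban1983to89
open Literature.MathematicalPhysics.QuantumFieldTheory.Balaban1983to89.T4Continuum
open Literature.MathematicalPhysics.QuantumFieldTheory.Balaban1983to89.Node00
open T4WeightBudget (RelWeightBound)
open T4IndicatorShell (ShellWeightBound)
open T4ContinuumYM4Torus (ForSmallCouplings)
open Summit.QuantumFields.BalabanUV.T4Continuum.Spine
open YMDAG.UVSplit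
open Summit.QuantumFields.YangMills.Theorems.K3V5Defs (RateReadingFn CutReading PHolderD4 KeyedRelWeight KeyedShellWeight PinnedAtLive)
open Summit.QuantumFields.YangMills.Theorems.K3V6Defs (KeyedCoreEdgeHolderD4V KeyedCoreEdgeHolderD4BFree keyedCoreEdgeHolderD4V_of_bFree)
open Summit.QuantumFields.YangMills.BalabanUVNodes.N20CoreEdgeShellDial (core_crOfRecord₁₃VAt_optShell relWeightBound_crOfRecord₁₃VAt_cutZero pinnedAtLive_crOfRecord₁₃V)
open Summit.QuantumFields.YangMills.BalabanUVNodes.N20CoreEdgeShellDialAscent (shellWeightBound_crOfRecord₁₃VAt_optShell_of_keyReading_of_fibreDev)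
open Summit.QuantumFields.YangMills.BalabanUVNodes.N20CoreEdgeShellDialDeviationNecessity (not_shellWeightBound_optShell_of_unsummable_fibreDev)
open Summit.QuantumFields.YangMills.BalabanUVNodes.N20CoreEdgeShellDialDeviationTower (shellWeightBound_crOfRecord₁₃VAt_optShell_of_keyReading_of_classLawTV)

-- the three free dials of stub 2 read PER TUPLE: the cut `jc`, the shell split `sh`, and the `Core` constants `cK` (bare function types, no def — as in module 13b)
variable (jc : CutReading) (sh : ShellSplit₁₃CoPH 2 0)
  (cK : (F : T4Family) → (θ : Stage13HParams F 2) → θ.Provisos₁₃CoPH F 2 → (ℕ → ℝ) → List (ULoop F) → ℕ → ℝ)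
  /- the displayed row «`sh` reads, at every tuple, module 13's ℓ¹-optimal split of the record's class weights at the constants `cK`» (a witness: module 13's
  `exists_optShellSplit 0 cK`) -/
  (hsh : ∀ (F : T4Family) (θ : Stage13HParams F 2) (hP : θ.Provisos₁₃CoPH F 2) (g₀ : ℕ → ℝ) (os : List (ULoop F)),
    sh F θ hP g₀ os =
      (fun K t x => max 0 (weightA₁₃ θ hP 0 g₀ os K t x - Real.exp (-cK F θ hP g₀ os K) * weightB₁₃ θ hP 0 g₀ os K t x),
       fun K t x => max 0 (weightB₁₃ θ hP 0 g₀ os K t x - Real.exp (cK F θ hP g₀ os K) * weightA₁₃ θ hP 0 g₀ os K t x)))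

/-! ## §1 The N19′ conjunct of `stub_expansion13HV` at the ℓ¹-optimal split: (B)-free shape and slot shape, every version -/

include hsh in
/-- **★★★ THE (B)-FREE N19′ FACE HOLDS AT THE ℓ¹-OPTIMAL SHELL SPLIT — EVERY `β`, EVERY RATE READING, EVERY CUT READING, EVERY CONSTANT READING.**
`KeyedCoreEdgeHolderD4BFree β cr⋆ rr` with `cr⋆ := crOfRecord₁₃V (jc …) sh⋆`: under `ForSmallCouplings` (by `.of_forall`) the holder hypothesis `PHolderD4 β D (rr …)` is NOT READ and
`∃ δ, Core … ∧ Summable δ` is module 13's `core_crOfRecord₁₃VAt_optShell` at `K₀ = 0`. [cite: King1986, (3.10)–(3.13) pp.656–657 (template only)] [bookkeeping] -/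
theorem keyedCoreEdgeHolderD4BFree_crOfRecord₁₃V_optShell (β : ℝ) (rr : RateReadingFn) :
    KeyedCoreEdgeHolderD4BFree β (fun F θ hP g₀ os => crOfRecord₁₃V (jc F θ hP g₀ os) sh F θ hP g₀ os) rr := by
  intro F θ hP _ _
  refine ForSmallCouplings.of_forall fun g₀ os _ => ?_
  exact ⟨_, core_crOfRecord₁₃VAt_optShell 0 (jc F θ hP g₀ os) sh θ hP g₀ os (cK F θ hP g₀ os) (hsh F θ hP g₀ os)⟩

include hsh in
/-- **★★★ THE N19′ CONJUNCT OF K3⁸'s `stub_expansion13HV` HOLDS AT THE ℓ¹-OPTIMAL SHELL SPLIT, AT EVERY VERSION SLOT** — `KeyedCoreEdgeHolderD4V β cr⋆ rr` for every `β`, rate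
reading, cut reading, constant reading (the (B)-free face through dag-n27-w1's mirrored transfer `keyedCoreEdgeHolderD4V_of_bFree`).  Located meaning (as at v5): under the free
`∃ sh` the N19′ slot is dischargeable by dials; its intended two-run content sits in `KeyedShellWeight cr⋆` (§2). [cite: King1986, (3.10)–(3.13) pp.656–657 (template only)] [bookkeeping] -/
theorem keyedCoreEdgeHolderD4V_crOfRecord₁₃V_optShell (β : ℝ) (rr : RateReadingFn) :
    KeyedCoreEdgeHolderD4V β (fun F θ hP g₀ os => crOfRecord₁₃V (jc F θ hP g₀ os) sh F θ hP g₀ os) rr :=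
  keyedCoreEdgeHolderD4V_of_bFree (keyedCoreEdgeHolderD4BFree_crOfRecord₁₃V_optShell jc sh cK hsh β rr)

include hsh in
/-- **★★ THREE OF `stub_expansion13HV`'s FIVE CONJUNCTS FROM NO ESTIMATE**: at `jc := 0` and the ℓ¹-optimal split, `PinnedAtLive ∧ KeyedRelWeight ∧ KeyedCoreEdgeHolderD4V β cr⋆ rr`
for EVERY `β` and EVERY rate reading (the pin by `rfl`, N20 by dag-n20-w2's cut-zero face p590852 through module 13, N19′ by §1).  What remains of the registered text is
`KeyedExtractionV cr⋆` (N27x, the extraction lanes) and `KeyedShellWeight cr⋆` (§2 ∕ §3). [cite: King1986, (3.10)–(3.13) pp.656–657 (template only)] [bookkeeping] -/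
theorem pinned_relWeight_coreEdgeV_optShell (β : ℝ) (rr : RateReadingFn) :
    PinnedAtLive (fun _ _ _ _ _ _ => 0) sh (fun F θ hP g₀ os => crOfRecord₁₃V (fun _ => 0) sh F θ hP g₀ os) ∧
      KeyedRelWeight (fun F θ hP g₀ os => crOfRecord₁₃V (fun _ => 0) sh F θ hP g₀ os) ∧
      KeyedCoreEdgeHolderD4V β (fun F θ hP g₀ os => crOfRecord₁₃V (fun _ => 0) sh F θ hP g₀ os) rr :=
  ⟨pinnedAtLive_crOfRecord₁₃V (fun _ _ _ _ _ _ => 0) sh,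
    fun _ θ hP _ _ g₀ os => relWeightBound_crOfRecord₁₃VAt_cutZero 0 sh θ hP g₀ os,
    keyedCoreEdgeHolderD4V_crOfRecord₁₃V_optShell (fun _ _ _ _ _ _ => 0) sh cK hsh β rr⟩

/-! ## §2 The fourth conjunct `KeyedShellWeight cr⋆` from the window-road letters (module 13L) or the class-law TV letter (module 13P), per guarded admissible tuple -/

include hsh in
/-- **★★ `KeyedShellWeight cr⋆` FROM THE LETTERS AT ANY KEY READING PLUS THE DEVIATION LETTERS** (any cut reading): a key reading `kr` and, per guarded admissible tuple,
summable fractions `w, v ≥ 0` carrying module 13K §2's two letters for the `kr`-COARSE weights (multipliers `e^{∓cK_K}`) and module 13L §2's two deviation letters — module 13L's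
★★★ BY NAME.  The four letters are the two-run content — NOT PRINTED for `d = 4`, NOT proved. [cite: Balaban1989LargeFieldII, Thm 1 + (0.1) pp.355–356, (1.80) p.384 (templates only)]
[bookkeeping] -/
theorem keyedShellWeight_crOfRecord₁₃V_optShell_of_keyReading_of_fibreDev (kr : KeyReading₁₃ 2 0)
    (hl : ∀ (F : T4Family) (θ : Stage13HParams F 2) (hP : θ.Provisos₁₃CoPH F 2), (θ.ZhUnity F 2 ∧ θ.SlotsNondegenerate₁₃ F 2) → θ.Admissible F 2 →
      ∀ (g₀ : ℕ → ℝ) (os : List (ULoop F)), ∃ (w v : ℕ → ℝ),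
        (∀ K, 0 ≤ w K) ∧ Summable w ∧ (∀ K, 0 ≤ v K) ∧ Summable v ∧ ∀ (K : ℕ) (t : ℝ), |t| ≤ 1 →
        (∑ u ∈ classSetK₁₃ θ 0 g₀ (kr F θ hP g₀ os) K, max 0 (weightAK₁₃ θ hP 0 g₀ os (kr F θ hP g₀ os) K t u - Real.exp (-cK F θ hP g₀ os K) * weightBK₁₃ θ hP 0 g₀ os (kr F θ hP g₀ os) K t u)
            ≤ w K * ∑ u ∈ classSetK₁₃ θ 0 g₀ (kr F θ hP g₀ os) K, weightAK₁₃ θ hP 0 g₀ os (kr F θ hP g₀ os) K t u) ∧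
        (∑ u ∈ classSetK₁₃ θ 0 g₀ (kr F θ hP g₀ os) K, max 0 (weightBK₁₃ θ hP 0 g₀ os (kr F θ hP g₀ os) K t u - Real.exp (cK F θ hP g₀ os K) * weightAK₁₃ θ hP 0 g₀ os (kr F θ hP g₀ os) K t u)
            ≤ w K * ∑ u ∈ classSetK₁₃ θ 0 g₀ (kr F θ hP g₀ os) K, weightBK₁₃ θ hP 0 g₀ os (kr F θ hP g₀ os) K t u) ∧
        (∑ x ∈ classSet₁₃ θ 0 g₀ K, max 0 (weightA₁₃ θ hP 0 g₀ os K t x -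
            weightAK₁₃ θ hP 0 g₀ os (kr F θ hP g₀ os) K t ((kr F θ hP g₀ os) K x) / weightBK₁₃ θ hP 0 g₀ os (kr F θ hP g₀ os) K t ((kr F θ hP g₀ os) K x) * weightB₁₃ θ hP 0 g₀ os K t x)
            ≤ v K * ∑ x ∈ classSet₁₃ θ 0 g₀ K, weightA₁₃ θ hP 0 g₀ os K t x) ∧
        (∑ x ∈ classSet₁₃ θ 0 g₀ K, max 0 (weightB₁₃ θ hP 0 g₀ os K t x -
            weightBK₁₃ θ hP 0 g₀ os (kr F θ hP g₀ os) K t ((kr F θ hP g₀ os) K x) / weightAK₁₃ θ hP 0 g₀ os (kr F θ hP g₀ os) K t ((kr F θ hP g₀ os) K x) * weightA₁₃ θ hP 0 g₀ os K t x)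
            ≤ v K * ∑ x ∈ classSet₁₃ θ 0 g₀ K, weightB₁₃ θ hP 0 g₀ os K t x)) :
    KeyedShellWeight (fun F θ hP g₀ os => crOfRecord₁₃V (jc F θ hP g₀ os) sh F θ hP g₀ os) := by
  intro F θ hP hG hθ g₀ os
  obtain ⟨w, v, hw0, hws, hv0, hvs, h⟩ := hl F θ hP hG hθ g₀ os
  exact shellWeightBound_crOfRecord₁₃VAt_optShell_of_keyReading_of_fibreDev 0 kr θ hP g₀ os (jc F θ hP g₀ os) sh (cK F θ hP g₀ os)
    (hsh F θ hP g₀ os) hw0 hws hv0 hvs (fun K t ht => (h K t ht).1) (fun K t ht => (h K t ht).2.1) (fun K t ht => (h K t ht).2.2.1)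
    (fun K t ht => (h K t ht).2.2.2)

include hsh in
/-- **★★ `KeyedShellWeight cr⋆` FROM THE LETTERS AT ANY KEY READING PLUS dag-n20-w4's CLASS-LAW TV LETTER** (any cut reading): a key reading `kr` and, per guarded admissible tuple,
a summable fraction `w ≥ 0` for the two coarse letters, positive totals on `|t| ≤ 1`, and a summable radius `r ≥ 0` with `|μ_A(S′) − μ_B(S′)| ≤ r_K` for every `S′ ⊆ classSet₁₃`
(p609004's `hρ` shape) — module 13P's ★★★ BY NAME (fraction `w + 2r`).  NOT PRINTED for `d = 4`, NOT proved. [cite: Balaban1989LargeFieldII, (1.80) p.384 (template only)] [bookkeeping] -/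
theorem keyedShellWeight_crOfRecord₁₃V_optShell_of_keyReading_of_classLawTV (kr : KeyReading₁₃ 2 0)
    (hl : ∀ (F : T4Family) (θ : Stage13HParams F 2) (hP : θ.Provisos₁₃CoPH F 2), (θ.ZhUnity F 2 ∧ θ.SlotsNondegenerate₁₃ F 2) → θ.Admissible F 2 →
      ∀ (g₀ : ℕ → ℝ) (os : List (ULoop F)), ∃ (w r : ℕ → ℝ),
        (∀ K, 0 ≤ w K) ∧ Summable w ∧ (∀ K, 0 ≤ r K) ∧ Summable r ∧ ∀ (K : ℕ) (t : ℝ), |t| ≤ 1 →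
        (∑ u ∈ classSetK₁₃ θ 0 g₀ (kr F θ hP g₀ os) K, max 0 (weightAK₁₃ θ hP 0 g₀ os (kr F θ hP g₀ os) K t u - Real.exp (-cK F θ hP g₀ os K) * weightBK₁₃ θ hP 0 g₀ os (kr F θ hP g₀ os) K t u)
            ≤ w K * ∑ u ∈ classSetK₁₃ θ 0 g₀ (kr F θ hP g₀ os) K, weightAK₁₃ θ hP 0 g₀ os (kr F θ hP g₀ os) K t u) ∧
        (∑ u ∈ classSetK₁₃ θ 0 g₀ (kr F θ hP g₀ os) K, max 0 (weightBK₁₃ θ hP 0 g₀ os (kr F θ hP g₀ os) K t u - Real.exp (cK F θ hP g₀ os K) * weightAK₁₃ θ hP 0 g₀ os (kr F θ hP g₀ os) K t u)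
            ≤ w K * ∑ u ∈ classSetK₁₃ θ 0 g₀ (kr F θ hP g₀ os) K, weightBK₁₃ θ hP 0 g₀ os (kr F θ hP g₀ os) K t u) ∧
        0 < ∑ x ∈ classSet₁₃ θ 0 g₀ K, weightA₁₃ θ hP 0 g₀ os K t x ∧ 0 < ∑ x ∈ classSet₁₃ θ 0 g₀ K, weightB₁₃ θ hP 0 g₀ os K t x ∧
        (∀ S' ⊆ classSet₁₃ θ 0 g₀ K,
          |(∑ x ∈ S', weightA₁₃ θ hP 0 g₀ os K t x) / (∑ x ∈ classSet₁₃ θ 0 g₀ K, weightA₁₃ θ hP 0 g₀ os K t x) -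
            (∑ x ∈ S', weightB₁₃ θ hP 0 g₀ os K t x) / (∑ x ∈ classSet₁₃ θ 0 g₀ K, weightB₁₃ θ hP 0 g₀ os K t x)| ≤ r K)) :
    KeyedShellWeight (fun F θ hP g₀ os => crOfRecord₁₃V (jc F θ hP g₀ os) sh F θ hP g₀ os) := by
  intro F θ hP hG hθ g₀ os
  obtain ⟨w, r, hw0, hws, hr0, hrs, h⟩ := hl F θ hP hG hθ g₀ os
  exact shellWeightBound_crOfRecord₁₃VAt_optShell_of_keyReading_of_classLawTV 0 kr θ hP g₀ os (jc F θ hP g₀ os) sh (cK F θ hP g₀ os)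
    (hsh F θ hP g₀ os) hw0 hws hr0 hrs (fun K t ht => (h K t ht).1) (fun K t ht => (h K t ht).2.1) (fun K t ht => (h K t ht).2.2.1)
    (fun K t ht => (h K t ht).2.2.2.1) (fun K t ht => (h K t ht).2.2.2.2)

/-! ## §3 The kill at the stub-text level: under a deviation floor at ONE guarded admissible tuple, `KeyedShellWeight cr⋆` fails for every constant reading -/

include hsh in
/-- **★★ THE ℓ¹-OPTIMAL-SHELL ROAD TO `stub_expansion13HV`'s N21 CONJUNCT IS CLOSED UNDER A DEVIATION FLOOR AT ONE TUPLE.**  If at ONE tuple `(F, θ, hP, g₀, os)` passing the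
stub's guards the run-A deviation of the record's class weights inside the classes of some key dial `kr` exceeds `d_K·Σ weightA₁₃` at some `|t_K| ≤ 1` for every `K`, with
`d ≥ 0` NOT summable, then `KeyedShellWeight cr⋆` is FALSE — for EVERY constant reading `cK` (and every cut reading): its `ShellWeightBound` at that tuple, read through dag-n20-d's
structure literal (`crOfRecord₁₃VAt_T ∕ _A ∕ _B ∕ _shA ∕ _shB`, all `rfl`) and the pin row `hsh`, is module 13's pair of pinned letters with fraction the canonical `Wsh`, which module
13N's `not_shellWeightBound_optShell_of_unsummable_fibreDev` refutes.  The floor is a HYPOTHESIS on Bałaban's two-run weights — NOT PRINTED, NOT measured; the all-dial form of the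
kill is module 13Q. [bookkeeping] -/
theorem not_keyedShellWeight_optShell_of_unsummable_fibreDevA {F : T4Family} (θ : Stage13HParams F 2) (hP : θ.Provisos₁₃CoPH F 2)
    (hG : θ.ZhUnity F 2 ∧ θ.SlotsNondegenerate₁₃ F 2) (hθ : θ.Admissible F 2) (g₀ : ℕ → ℝ) (os : List (ULoop F))
    (kr : ℕ → (Σ K, SiteSeqKey F (0 + K)) → (Σ K, SiteSeqKey F (0 + K))) {d : ℕ → ℝ} (hd0 : ∀ K, 0 ≤ d K) (hds : ¬ Summable d)
    (hfloor : ∀ K, ∃ t, |t| ≤ 1 ∧ d K * ∑ x ∈ classSet₁₃ θ 0 g₀ K, weightA₁₃ θ hP 0 g₀ os K t x <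
      ∑ x ∈ classSet₁₃ θ 0 g₀ K, max 0 (weightA₁₃ θ hP 0 g₀ os K t x -
        weightAK₁₃ θ hP 0 g₀ os kr K t (kr K x) / weightBK₁₃ θ hP 0 g₀ os kr K t (kr K x) * weightB₁₃ θ hP 0 g₀ os K t x)) :
    ¬ KeyedShellWeight (fun F θ hP g₀ os => crOfRecord₁₃V (jc F θ hP g₀ os) sh F θ hP g₀ os) := by
  intro h
  letI : ∀ Kc, DecidableEq (SiteSeqKey F Kc) := fun _ => Classical.decEq _
  have hS : ShellWeightBound 1 (classSet₁₃ θ 0 g₀) (weightA₁₃ θ hP 0 g₀ os) (weightB₁₃ θ hP 0 g₀ os) (sh F θ hP g₀ os).1 (sh F θ hP g₀ os).2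
      (crOfRecord₁₃V (jc F θ hP g₀ os) sh F θ hP g₀ os).Wsh := h F θ hP hG hθ g₀ os
  rw [hsh F θ hP g₀ os] at hS
  exact not_shellWeightBound_optShell_of_unsummable_fibreDev (l₀ := 1) (T := classSet₁₃ θ 0 g₀) (A := weightA₁₃ θ hP 0 g₀ os) (B := weightB₁₃ θ hP 0 g₀ os)
    (π := kr) hd0 hds hfloor (cK F θ hP g₀ os) _ hS

end Summit.QuantumFields.YangMills.BalabanUVNodes.N20CoreEdgeShellDialStubTextK3V6

end
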